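import Summits.NavierStokesRegularity.NavierStokesRegularity.Theorems.TypeILiouvilleTypeIliouvilleNoTypeIIEternalEnergyLiouvilleLimitSet
import Summits.NavierStokesRegularity.NavierStokesRegularity.Theorems.TypeILiouvilleTypeIliouvilleNoTypeIIEternalEnergyLiouvilleAxisym
import HarnessLib

/-!
# Two more empty strata of the EEL′ limit set: axisymmetric-no-swirl translation limits, and
# discretely self-similar profiles (crux `TypeIliouvilleNoTypeII`, stmt-NavierStokesRegularity-0056;
# rigidity residual EEL′ of the pressure-free eternal split)

Helper file (theorems only), completing `…EternalEnergyLiouvilleLimitSet.lean` (the EEL′ class —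
bounded eternal Oseen-mild smooth divergence-free fields with `A_ess, C, E ≤ I` on all parabolic
balls — is compact modulo space–time translations, and its steady / time-periodic translation limits
vanish):

* `limit_eq_zero_of_axisymNoSwirl` — every translation limit of an EEL′-class profile that is
  AXISYMMETRIC WITHOUT SWIRL (about the `x₃`-axis) is identically zero (the limit lies in the class,
  `exists_limit_of_translates`; KNSS Thm 5.2 + the `A`-bound, `eternal_eq_zero_of_axisymNoSwirl_of_cknAEss_le`);
* `eq_zero_of_dss` — the DISCRETELY SELF-SIMILAR stratum is empty for a trivial reason recorded
  here for completeness: a bounded field with `v(s, y) = μ • v(μ² s, μ y)` for some `μ > 1` satisfies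
  `‖v(s, y)‖ = μ^{-k} ‖v(μ^{-2k} s, μ^{-k} y)‖ ≤ μ^{-k} N → 0`; no equation and no `A, C, E` are needed.

WHAT THIS IS NOT: not NS; EEL′ stays OPEN (transient, non-symmetric, non-self-similar core).
[folklore]
-/

noncomputable section

-- the summit and its single problem share the name `NavierStokesRegularity` (D-0017 nested layout)
set_option linter.dupNamespace false

open Set Function Filter Topology MeasureTheory Metric
open scoped NNReal ENNReal

namespace Summit.NavierStokesRegularity.NavierStokesRegularity.Theorems.TypeIliouvilleNoTypeII.TypeIIZoom

open Literature.Analysis Literature.Analysis.FluidPDE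

variable {v W : ℝ → EuclideanSpace ℝ (Fin 3) → EuclideanSpace ℝ (Fin 3)}

/-- **Every axisymmetric-no-swirl translation limit of an EEL′-class profile is zero.**  If the
translates `v(· + c_k, · + a_k)` of a bounded eternal Oseen-mild smooth divergence-free field with
`A_ess, C, E ≤ I < ∞` on all balls converge at every point to a field `W` whose slices are
axisymmetric about the `x₃`-axis and swirl-free, then `W ≡ 0`. [cite: KochNadirashviliSereginSverak2009, Thm 5.2 (arXiv:0709.3599 pp. 9–10)] -/
theorem limit_eq_zero_of_axisymNoSwirl (hv : ContDiff ℝ (⊤ : ℕ∞) (uncurry v))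
    (hdiv : ∀ t, VectorCalculus.IsDivFree (v t))
    (hmild : ∀ s t : ℝ, s < t → ∀ x, v t x = heatFlow (v s) (t - s) x - oseenDuhamel 1 s v v t x)
    {N : ℝ} (hbd : ∀ (t : ℝ) (x : EuclideanSpace ℝ (Fin 3)), ‖v t x‖ ≤ N) {I : ℝ≥0∞} (hI : I ≠ ⊤)
    (hball : ∀ r : ℝ, 0 < r → ∀ z : ℝ × EuclideanSpace ℝ (Fin 3),
      cknAEss r z v ≤ I ∧ cknC r z v ≤ I ∧ cknE r z (fun s y => fderiv ℝ (v s) y) ≤ I)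
    {c : ℕ → ℝ} {a : ℕ → EuclideanSpace ℝ (Fin 3)}
    (hlim : ∀ t x, Tendsto (fun k => v (t + c k) (x + a k)) atTop (𝓝 (W t x)))
    (haxi : ∀ t, IsAxisymmetric (W t)) (hswirl : ∀ t, HasNoSwirl (W t))
    (t : ℝ) (y : EuclideanSpace ℝ (Fin 3)) : W t y = 0 := by
  obtain ⟨φ, hφ, W', hW', hW'div, hW'mild, hW'bd, hW'I, hW'lim, -⟩ :=
    exists_limit_of_translates hv hdiv hmild hbd hball c a
  have heq : ∀ t x, W' t x = W t x := fun t x =>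
    tendsto_nhds_unique (hW'lim t x) ((hlim t x).comp hφ.tendsto_atTop)
  have hfun : W' = W := funext fun t => funext fun x => heq t x
  rw [hfun] at hW' hW'div hW'mild hW'bd hW'I
  exact eternal_eq_zero_of_axisymNoSwirl_of_cknAEss_le hW' hW'div hW'mild ⟨N, hW'bd⟩ haxi hswirl hI
    (fun r hr z => (hW'I r hr z).1) t y

/-- **The discretely self-similar stratum is empty (trivially).**  A bounded field on `ℝ × ℝ³` which
is discretely self-similar about the origin in the Navier–Stokes scaling, `v(s, y) = μ • v(μ² s, μ y)`
for some `μ > 1`, vanishes identically: iterating the scaling backwards,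
`‖v(s, y)‖ = μ^{-k} ‖v(μ^{-2k} s, μ^{-k} y)‖ ≤ μ^{-k} N → 0`.  No equation is used. [folklore] -/
theorem eq_zero_of_dss {N : ℝ} (hbd : ∀ (t : ℝ) (x : EuclideanSpace ℝ (Fin 3)), ‖v t x‖ ≤ N)
    {μ : ℝ} (hμ : 1 < μ) (hdss : ∀ (s : ℝ) (y : EuclideanSpace ℝ (Fin 3)), v s y = μ • v (μ ^ 2 * s) (μ • y))
    (s : ℝ) (y : EuclideanSpace ℝ (Fin 3)) : v s y = 0 := by
  have hμ0 : 0 < μ := one_pos.trans hμ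
  -- backward iteration of the scaling law
  have hiter : ∀ k : ℕ, ∀ (s : ℝ) (y : EuclideanSpace ℝ (Fin 3)),
      ‖v s y‖ ≤ (μ ^ k)⁻¹ * N := by
    intro k
    induction k with
    | zero => intro s y; simpa using hbd s y
    | succ k ih =>
      intro s y
      -- `v s y = μ⁻¹ • ... ` read backwards: `v (μ⁻² s) (μ⁻¹ y)`-scaling
      have h := hdss ((μ ^ 2)⁻¹ * s) (μ⁻¹ • y)
      rw [← mul_assoc, mul_inv_cancel₀ (by positivity), one_mul, smul_smul,
        mul_inv_cancel₀ hμ0.ne', one_smul] at h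
      -- h : v ((μ^2)⁻¹ * s) (μ⁻¹ • y) = μ • v s y
      have h2 : v s y = μ⁻¹ • v ((μ ^ 2)⁻¹ * s) (μ⁻¹ • y) := by
        rw [h, smul_smul, inv_mul_cancel₀ hμ0.ne', one_smul]
      calc ‖v s y‖ = μ⁻¹ * ‖v ((μ ^ 2)⁻¹ * s) (μ⁻¹ • y)‖ := by
            rw [h2, norm_smul, norm_inv, Real.norm_of_nonneg hμ0.le]
        _ ≤ μ⁻¹ * ((μ ^ k)⁻¹ * N) := mul_le_mul_of_nonneg_left (ih _ _) (inv_nonneg.2 hμ0.le)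
        _ = (μ ^ (k + 1))⁻¹ * N := by rw [pow_succ, mul_inv]; ring
  have hlim : Tendsto (fun k : ℕ => (μ ^ k)⁻¹ * N) atTop (𝓝 0) := by
    have h := (tendsto_inv_atTop_zero.comp (tendsto_pow_atTop_atTop_of_one_lt hμ)).mul_const N
    simpa using h
  have h0 : ‖v s y‖ ≤ 0 :=
    ge_of_tendsto' hlim fun k => hiter k s y
  exact norm_le_zero_iff.1 h0

end Summit.NavierStokesRegularity.NavierStokesRegularity.Theorems.TypeIliouvilleNoTypeII.TypeIIZoom

end
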